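/-
Lead `ym-line-sgb-k1` (seat prover-ym-line-sgb-k1-g0-0), route `SteinGapBootstrap`, crux `SteinBlockTransferG`
(stmt-QuantumFields-22998), line `birth`: the crux AS FILED from the all-`G` cold-box floor (BOX_G ∧ BULK_G), by the landed reduction.
-/
import Summits.QuantumFields.YangMills.Theorems.SteinGapBootstrapSteinBlockTransferGFloorRate

/-!
# Crux `SteinBlockTransferG` AS FILED is a corollary of the all-`G` torus plaquette floor (BOX_G ∧ BULK_G ∧ FLOOR)

Composition of the two landed helper files of the line (`…ClusterRate`: free exponents `K, δ` let the clustering rate absorb the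
bound; `…FloorRate`: the torus plaquette floor bounds the clustering rate by `β^{-A/2}`):

* `SteinBlockTransferG_of_polySeparationFloorAllG`: if every compact simple `G` and faithful unitary `r` admit exponents `A, κ > 0` with
  `PolySeparationPlaquetteFloor 4 r.ρ 1 2 A κ`, then `SteinBlockTransferG`;
* `SteinBlockTransferG_of_boxBulkAllG`: the same from the all-`G` forms of the two cruxes of route `WeakCouplingRates` — BOX
  (`BoxTwoPointDomination r.ρ A θ c` below a ceiling `θ₀`) and BULK (`BulkDominatesBox r.ρ A θ` under every ceiling) — written in the
  currency of `WeakCouplingRates` (these are, verbatim, the bodies of the cruxes `BoxFloorAllGroups` / `BulkAllGroups` of route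
  `ColdBoxAllGroups` and `ColdBoxTwoPointFloorAllG` / `BulkDominatesColdBoxAllG` of route `AllGroupsColdBox`), with the tree's proved
  FLOOR `curvatureCorrPowerFloor_proof` and glue `polySeparationPlaquetteFloor_of_box`.

So the crux as filed closes, with no generator comparison, the day the all-`G` BOX/BULK engine lands — at which point the same inputs
already give the route's target `XiPow` directly (`massGapPowerDecayOf_of_box`).  Recorded for the planner of record (ym-idea-4): the
Stein content of the line lives entirely in the XL stub `stub_steinTransferAllAxes`, which is the crux minus the (landed) axis-transport
bookkeeping.  HONEST FRAMING: RECORD-label rung R2ξ′ only (an UPPER bound on lattice gaps); nothing here bears on the Yang–Mills mass gap.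
-/

set_option autoImplicit false

noncomputable section

open MeasureTheory Filter Topology
open Literature.MathematicalPhysics.QuantumFieldTheory
open Literature.MathematicalPhysics.QuantumLattice
open Summit.QuantumFields.YangMills.Theorems.WeakCouplingRates

namespace Summit.QuantumFields.YangMills.Theorems.SteinGapBootstrap

/-- **The crux as filed from the all-`G` torus plaquette floor.**  If for every compact simple `G` and faithful unitary lattice
representation `r` there are `A, κ > 0` with `PolySeparationPlaquetteFloor 4 r.ρ 1 2 A κ` (a volume-uniform power-law floor under the
torus plaquette–plaquette correlator at separation `⌈β^A⌉`), then `SteinBlockTransferG` — by `clusterRate_of_polySeparationFloor` and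
`SteinBlockTransferG_of_clusterRate`. -/
theorem SteinBlockTransferG_of_polySeparationFloorAllG
    (H : ∀ (G : Type) [Group G] [TopologicalSpace G] [IsTopologicalGroup G] [CompactSpace G],
      IsCompactSimpleLieGroup G →
      letI : MeasurableSpace G := borel G
      haveI : BorelSpace G := ⟨rfl⟩
      ∀ r : LatticeRep G, ∃ A κ : ℝ, 0 < A ∧ 0 < κ ∧ PolySeparationPlaquetteFloor 4 r.ρ 1 2 A κ) :
    Summit.QuantumFields.YangMills.Theses.SteinGapBootstrap.SteinBlockTransferG := by
  refine SteinBlockTransferG_of_clusterRate fun G _ _ _ _ hG => ?_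
  letI : MeasurableSpace G := borel G
  haveI : BorelSpace G := ⟨rfl⟩
  intro r
  obtain ⟨A, κ, hA, hκ, hfloor⟩ := H G hG r
  obtain ⟨β₁, hβ₁⟩ := clusterRate_of_polySeparationFloor (G := G) r.ρ r.continuous (i := 1) (j := 2)
    (by decide) (by decide) hA hκ hfloor
  exact ⟨A / 2, β₁, by linarith, hβ₁⟩

/-- **The crux as filed from the all-`G` BOX ∧ BULK engine** (the bodies of the cruxes of routes `ColdBoxAllGroups` / `AllGroupsColdBox`,
stated in the currency of `WeakCouplingRates`; FLOOR is the tree theorem `curvatureCorrPowerFloor_proof`): Gaussian domination of the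
cold-box two-plaquette covariance below a ceiling `θ₀` (BOX) and volume-uniform domination of the box covariance by the torus states under
every ceiling (BULK), for every compact simple `G` and faithful unitary `r`, imply `SteinBlockTransferG` — with no Stein generator
comparison. -/
theorem SteinBlockTransferG_of_boxBulkAllG
    (hBox : ∀ (G : Type) [Group G] [TopologicalSpace G] [IsTopologicalGroup G] [CompactSpace G],
      IsCompactSimpleLieGroup G →
      letI : MeasurableSpace G := borel G
      haveI : BorelSpace G := ⟨rfl⟩
      ∀ r : LatticeRep G, ∃ θ₀ : ℝ, 0 < θ₀ ∧ ∀ A θ : ℝ, 0 < A → A < θ → θ ≤ θ₀ →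
        ∃ c : ℝ, 0 < c ∧ BoxTwoPointDomination r.ρ A θ c)
    (hBulk : ∀ (G : Type) [Group G] [TopologicalSpace G] [IsTopologicalGroup G] [CompactSpace G],
      IsCompactSimpleLieGroup G →
      letI : MeasurableSpace G := borel G
      haveI : BorelSpace G := ⟨rfl⟩
      ∀ r : LatticeRep G, ∀ θ₀ : ℝ, 0 < θ₀ → ∃ A θ : ℝ, 0 < A ∧ A < θ ∧ θ ≤ θ₀ ∧ BulkDominatesBox r.ρ A θ) :
    Summit.QuantumFields.YangMills.Theses.SteinGapBootstrap.SteinBlockTransferG := by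
  refine SteinBlockTransferG_of_polySeparationFloorAllG fun G _ _ _ _ hG => ?_
  letI : MeasurableSpace G := borel G
  haveI : BorelSpace G := ⟨rfl⟩
  intro r
  obtain ⟨θ₀, hθ₀, hbox⟩ := hBox G hG r
  obtain ⟨A, θ, hA, hAθ, hθ, hbulk⟩ := hBulk G hG r θ₀ hθ₀
  obtain ⟨c, hc, hboxd⟩ := hbox A θ hA hAθ hθ
  obtain ⟨κ, hκ, hfloor⟩ := polySeparationPlaquetteFloor_of_box r.ρ hA hc hboxd hbulk curvatureCorrPowerFloor_proof
  exact ⟨A, κ, hA, hκ, hfloor⟩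

end Summit.QuantumFields.YangMills.Theorems.SteinGapBootstrap

end
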